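import Summits.AtomisticToContinuum.Crystallization.Theorems.FreeSplittingCertificatesStrictSplittingRuleFarPencilGrowthIntegral

/-!
# `StrictSplittingRule` (stmt-AtomisticToContinuum-12560): uniform bounds, measurability and dominating functions for the far-ledger densities (P1 transfer)

Route `FreeSplittingCertificates`, crux r3 `StrictSplittingRule` (H12⋆ = `stub_coreJointCoercive`), unit b2b-freesplit-B gen 12.
VALUE = the dominated-convergence bookkeeping for `farPencil_weighted_integral_le_of_locallyAffine` (…FarPencilLocallyAffine) — NOT a proof of H12⋆,
NOT summit progress.

* Pointwise algebra: `abs_fpNum_le` (`|Num| ≤ (111/8)K²|x|⁻⁶ + (27/2)V²|x|⁻⁸`), `abs_fpDen_le` (`|Den| ≤ (108/5)K²|x|⁻⁶`), `abs_fpFlux_le`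
  (`|Φⱼ| ≤ 24|x|⁻⁸‖x‖W² + 6K|x|⁻⁶W`) under `|∂ᵢvⱼ| ≤ K`, `‖v‖ ≤ V + K‖x‖` (resp. `≤ W`) — the bounds a `K`-Lipschitz family satisfies uniformly.
* Measurability of the three integrands `χ²Num`, `χ²Den`, `2χ⟪∇χ,Φ⟫` for an arbitrary continuous field (`fderiv` is Borel).
* Integrability of the two dominating functions `χ²(c₃|x|⁻⁶ + c₄|x|⁻⁸)` and `(Σⱼ|2χ∂ⱼχ|)·(flux bound)`.
-/

noncomputable section

open MeasureTheory Topology Filter Asymptotics Metric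
open scoped NNReal

namespace Summit.AtomisticToContinuum.Crystallization.Theorems.StrictSplittingRuleBirth

/-! ## Pointwise algebra: bounds of the three densities in terms of `|∇v| ≤ K`, `‖v‖ ≤ W` -/

/-- Cauchy–Schwarz in `ℝ³`: `⟪x,w⟫² ≤ |x|²|w|²`. -/
theorem fpDot_sq_le (x w : Fin 3 → ℝ) : fpDot x w ^ 2 ≤ fpSq x * fpSq w := by
  unfold fpDot fpSq
  nlinarith [sq_nonneg (x 0 * w 1 - x 1 * w 0), sq_nonneg (x 0 * w 2 - x 2 * w 0), sq_nonneg (x 1 * w 2 - x 2 * w 1)]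

/-- `|x|²·|x|⁻² ≤ 1` (it is `1` or, at the origin, `0`). -/
theorem fpSq_mul_inv_le_one (x : Fin 3 → ℝ) : fpSq x * (fpSq x)⁻¹ ≤ 1 := by
  by_cases h : fpSq x = 0
  · simp [h]
  · rw [mul_inv_cancel₀ h]

/-- `|G|² ≤ 9K²` when every entry is bounded by `K`. -/
theorem fpFrob_le_of_abs_le {G : Fin 3 → Fin 3 → ℝ} {K : ℝ} (hG : ∀ i j, |G i j| ≤ K) : fpFrob G ≤ 9 * K ^ 2 := by
  have h : ∀ i j, G i j ^ 2 ≤ K ^ 2 := fun i j => by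
    have := hG i j
    rw [← sq_abs]; exact pow_le_pow_left₀ (abs_nonneg _) this 2
  unfold fpFrob
  linarith [h 0 0, h 0 1, h 0 2, h 1 0, h 1 1, h 1 2, h 2 0, h 2 1, h 2 2]

/-- `0 ≤ Rec(G) ≤ (108/5)K²` when every entry is bounded by `K`. -/
theorem fpRec_le_of_abs_le {G : Fin 3 → Fin 3 → ℝ} {K : ℝ} (hG : ∀ i j, |G i j| ≤ K) : fpRec G ≤ 108 / 5 * K ^ 2 := by
  have h : ∀ i j, G i j ^ 2 ≤ K ^ 2 := fun i j => by
    have := hG i j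
    rw [← sq_abs]; exact pow_le_pow_left₀ (abs_nonneg _) this 2
  have htr : fpTr G ^ 2 ≤ 9 * K ^ 2 := by
    unfold fpTr
    nlinarith [h 0 0, h 1 1, h 2 2, sq_nonneg (G 0 0 - G 1 1), sq_nonneg (G 0 0 - G 2 2), sq_nonneg (G 1 1 - G 2 2)]
  have hsym : fpSymSq G ≤ 9 * K ^ 2 := by
    unfold fpSymSq
    nlinarith [h 0 0, h 1 1, h 2 2, h 0 1, h 1 0, h 0 2, h 2 0, h 1 2, h 2 1, sq_nonneg (G 0 1 - G 1 0),
      sq_nonneg (G 0 2 - G 2 0), sq_nonneg (G 1 2 - G 2 1)]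
  unfold fpRec
  linarith

/-- `|w|² ≤ 6V² + 6K²|x|²` when `‖w‖ ≤ V + K‖x‖`. -/
theorem fpSq_le_of_norm_le {x w : Fin 3 → ℝ} {K V : ℝ} (hw : ‖w‖ ≤ V + K * ‖x‖) :
    fpSq w ≤ 6 * V ^ 2 + 6 * K ^ 2 * fpSq x := by
  have h1 : fpSq w ≤ 3 * ‖w‖ ^ 2 := fpSq_le_three_mul_norm_sq w
  have h2 : ‖w‖ ^ 2 ≤ (V + K * ‖x‖) ^ 2 := pow_le_pow_left₀ (norm_nonneg _) hw 2
  have h3 : (V + K * ‖x‖) ^ 2 ≤ 2 * V ^ 2 + 2 * (K * ‖x‖) ^ 2 := by nlinarith [sq_nonneg (V - K * ‖x‖)]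
  have h4 : (K * ‖x‖) ^ 2 ≤ K ^ 2 * fpSq x := by
    rw [mul_pow]; exact mul_le_mul_of_nonneg_left (norm_sq_le_fpSq x) (sq_nonneg K)
  nlinarith

/-- **Demand density bound**: `|Num(x,w,G)| ≤ (111/8)K²|x|⁻⁶ + (27/2)V²|x|⁻⁸` when `|Gᵢⱼ| ≤ K` and `‖w‖ ≤ V + K‖x‖`. -/
theorem abs_fpNum_le {x w : Fin 3 → ℝ} {G : Fin 3 → Fin 3 → ℝ} {K V : ℝ}
    (hG : ∀ i j, |G i j| ≤ K) (hw : ‖w‖ ≤ V + K * ‖x‖) :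
    |fpNum x w G| ≤ 111 / 8 * K ^ 2 * (fpSq x)⁻¹ ^ 3 + 27 / 2 * V ^ 2 * (fpSq x)⁻¹ ^ 4 := by
  set t := (fpSq x)⁻¹ with ht
  have ht0 : 0 ≤ t := inv_nonneg.2 (fpSq_nonneg x)
  have hst : fpSq x * t ≤ 1 := fpSq_mul_inv_le_one x
  have hfrob := fpFrob_le_of_abs_le hG
  have hfrob0 : 0 ≤ fpFrob G := by unfold fpFrob; positivity
  have hws := fpSq_le_of_norm_le hw
  have hw0 : 0 ≤ fpSq w := fpSq_nonneg w
  have hdot := fpDot_sq_le x w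
  -- the three terms
  have h1 : |1 / 24 * t ^ 3 * fpFrob G| ≤ 3 / 8 * K ^ 2 * t ^ 3 := by
    rw [abs_of_nonneg (by positivity)]
    nlinarith [pow_nonneg ht0 3]
  have h2 : |2 * t ^ 5 * fpDot x w ^ 2| ≤ 12 * V ^ 2 * t ^ 4 + 12 * K ^ 2 * t ^ 3 := by
    rw [abs_of_nonneg (by positivity)]
    -- t⁵⟪x,w⟫² ≤ t⁵ s |w|² = t⁴ (s t) |w|² ≤ t⁴ |w|² ≤ t⁴ (6V² + 6K² s) ≤ 6V² t⁴ + 6K² t³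
    have a1 : t ^ 5 * fpDot x w ^ 2 ≤ t ^ 4 * fpSq w := by
      calc t ^ 5 * fpDot x w ^ 2 ≤ t ^ 5 * (fpSq x * fpSq w) := mul_le_mul_of_nonneg_left hdot (pow_nonneg ht0 5)
        _ = t ^ 4 * fpSq w * (fpSq x * t) := by ring
        _ ≤ t ^ 4 * fpSq w * 1 := mul_le_mul_of_nonneg_left hst (by positivity)
        _ = t ^ 4 * fpSq w := by ring
    have a2 : t ^ 4 * fpSq w ≤ 6 * V ^ 2 * t ^ 4 + 6 * K ^ 2 * t ^ 3 := by
      calc t ^ 4 * fpSq w ≤ t ^ 4 * (6 * V ^ 2 + 6 * K ^ 2 * fpSq x) := mul_le_mul_of_nonneg_left hws (pow_nonneg ht0 4)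
        _ = 6 * V ^ 2 * t ^ 4 + 6 * K ^ 2 * t ^ 3 * (fpSq x * t) := by ring
        _ ≤ 6 * V ^ 2 * t ^ 4 + 6 * K ^ 2 * t ^ 3 * 1 := by gcongr
        _ = 6 * V ^ 2 * t ^ 4 + 6 * K ^ 2 * t ^ 3 := by ring
    linarith
  have h3 : |1 / 4 * t ^ 4 * (w 0 ^ 2 + w 1 ^ 2 + w 2 ^ 2)| ≤ 3 / 2 * V ^ 2 * t ^ 4 + 3 / 2 * K ^ 2 * t ^ 3 := by
    have hw' : w 0 ^ 2 + w 1 ^ 2 + w 2 ^ 2 = fpSq w := rfl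
    rw [hw', abs_of_nonneg (by positivity)]
    have a2 : t ^ 4 * fpSq w ≤ 6 * V ^ 2 * t ^ 4 + 6 * K ^ 2 * t ^ 3 := by
      calc t ^ 4 * fpSq w ≤ t ^ 4 * (6 * V ^ 2 + 6 * K ^ 2 * fpSq x) := mul_le_mul_of_nonneg_left hws (pow_nonneg ht0 4)
        _ = 6 * V ^ 2 * t ^ 4 + 6 * K ^ 2 * t ^ 3 * (fpSq x * t) := by ring
        _ ≤ 6 * V ^ 2 * t ^ 4 + 6 * K ^ 2 * t ^ 3 * 1 := by gcongr
        _ = 6 * V ^ 2 * t ^ 4 + 6 * K ^ 2 * t ^ 3 := by ring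
    linarith
  have hsplit : fpNum x w G = 1 / 24 * t ^ 3 * fpFrob G + 2 * t ^ 5 * fpDot x w ^ 2 -
      1 / 4 * t ^ 4 * (w 0 ^ 2 + w 1 ^ 2 + w 2 ^ 2) := by rw [ht]; rfl
  rw [hsplit]
  calc |1 / 24 * t ^ 3 * fpFrob G + 2 * t ^ 5 * fpDot x w ^ 2 - 1 / 4 * t ^ 4 * (w 0 ^ 2 + w 1 ^ 2 + w 2 ^ 2)|
      ≤ |1 / 24 * t ^ 3 * fpFrob G + 2 * t ^ 5 * fpDot x w ^ 2| + |1 / 4 * t ^ 4 * (w 0 ^ 2 + w 1 ^ 2 + w 2 ^ 2)| :=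
        abs_sub _ _
    _ ≤ |1 / 24 * t ^ 3 * fpFrob G| + |2 * t ^ 5 * fpDot x w ^ 2| + |1 / 4 * t ^ 4 * (w 0 ^ 2 + w 1 ^ 2 + w 2 ^ 2)| := by
        linarith [abs_add_le (1 / 24 * t ^ 3 * fpFrob G) (2 * t ^ 5 * fpDot x w ^ 2)]
    _ ≤ 111 / 8 * K ^ 2 * t ^ 3 + 27 / 2 * V ^ 2 * t ^ 4 := by linarith

/-- **Receipt density bound**: `0 ≤ Den(x,G) ≤ (108/5)K²|x|⁻⁶`. -/
theorem abs_fpDen_le {x : Fin 3 → ℝ} {G : Fin 3 → Fin 3 → ℝ} {K : ℝ} (hG : ∀ i j, |G i j| ≤ K) :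
    |fpDen x G| ≤ 108 / 5 * K ^ 2 * (fpSq x)⁻¹ ^ 3 := by
  have ht0 : 0 ≤ (fpSq x)⁻¹ := inv_nonneg.2 (fpSq_nonneg x)
  unfold fpDen
  rw [abs_of_nonneg (mul_nonneg (pow_nonneg ht0 3) (fpRec_nonneg G))]
  nlinarith [fpRec_le_of_abs_le hG, pow_nonneg ht0 3]

/-- **Flux bound**: `|Φⱼ(y)| ≤ 24|y|⁻⁸‖y‖W² + 6K|y|⁻⁶W` when `|∂ᵢvⱼ(y)| ≤ K` and `‖v y‖ ≤ W`. -/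
theorem abs_fpFlux_le {v : (Fin 3 → ℝ) → (Fin 3 → ℝ)} {y : Fin 3 → ℝ} {K W : ℝ} (hK : 0 ≤ K) (hW : 0 ≤ W)
    (hG : ∀ i j, |fpGrad v y i j| ≤ K) (hw : ‖v y‖ ≤ W) (j : Fin 3) :
    |fpFlux v y j| ≤ 24 * (fpSq y)⁻¹ ^ 4 * ‖y‖ * W ^ 2 + 6 * K * (fpSq y)⁻¹ ^ 3 * W := by
  set t := (fpSq y)⁻¹ with ht
  set w := v y with hw'
  set G := fpGrad v y with hG'
  have ht0 : 0 ≤ t := inv_nonneg.2 (fpSq_nonneg y)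
  have hyi : ∀ i, |y i| ≤ ‖y‖ := fun i => by simpa [Real.norm_eq_abs] using norm_le_pi_norm y i
  have hwi : ∀ i, |w i| ≤ W := fun i => le_trans (by simpa [Real.norm_eq_abs] using norm_le_pi_norm w i) hw
  have hwn : ‖w‖ ≤ W := hw
  have hw0 : 0 ≤ ‖w‖ := norm_nonneg _
  have hsqw : fpSq w ≤ 3 * W ^ 2 := le_trans (fpSq_le_three_mul_norm_sq w) (by nlinarith)
  have hsqw0 : 0 ≤ fpSq w := fpSq_nonneg w
  have hdot : |fpDot y w| ≤ 3 * ‖y‖ * W := by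
    unfold fpDot
    have e : ∀ i, |y i * w i| ≤ ‖y‖ * W := fun i => by
      rw [abs_mul]; exact mul_le_mul (hyi i) (hwi i) (abs_nonneg _) (norm_nonneg _)
    calc |y 0 * w 0 + y 1 * w 1 + y 2 * w 2| ≤ |y 0 * w 0| + |y 1 * w 1| + |y 2 * w 2| := abs_add_three _ _ _
      _ ≤ 3 * ‖y‖ * W := by linarith [e 0, e 1, e 2]
  have htr : |fpTr G| ≤ 3 * K := by
    unfold fpTr
    calc |G 0 0 + G 1 1 + G 2 2| ≤ |G 0 0| + |G 1 1| + |G 2 2| := abs_add_three _ _ _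
      _ ≤ 3 * K := by linarith [hG 0 0, hG 1 1, hG 2 2]
  -- first bracket
  have b1 : |fpSq w * y j + 7 * fpDot y w * w j| ≤ 24 * ‖y‖ * W ^ 2 := by
    have e1 : |fpSq w * y j| ≤ 3 * W ^ 2 * ‖y‖ := by
      rw [abs_mul, abs_of_nonneg hsqw0]; exact mul_le_mul hsqw (hyi j) (abs_nonneg _) (by positivity)
    have e2 : |7 * fpDot y w * w j| ≤ 7 * (3 * ‖y‖ * W) * W := by
      rw [abs_mul, abs_mul, abs_of_pos (by norm_num : (0:ℝ) < 7)]
      exact mul_le_mul (mul_le_mul_of_nonneg_left hdot (by norm_num)) (hwi j) (abs_nonneg _) (by positivity)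
    calc |fpSq w * y j + 7 * fpDot y w * w j| ≤ |fpSq w * y j| + |7 * fpDot y w * w j| := abs_add_le _ _
      _ ≤ 24 * ‖y‖ * W ^ 2 := by nlinarith
  -- second bracket
  have b2 : |w 0 * G 0 j + w 1 * G 1 j + w 2 * G 2 j - fpTr G * w j| ≤ 6 * K * W := by
    have e : ∀ i, |w i * G i j| ≤ W * K := fun i => by
      rw [abs_mul]; exact mul_le_mul (hwi i) (hG i j) (abs_nonneg _) hW
    have e4 : |fpTr G * w j| ≤ 3 * K * W := by
      rw [abs_mul]; exact mul_le_mul htr (hwi j) (abs_nonneg _) (by positivity)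
    calc |w 0 * G 0 j + w 1 * G 1 j + w 2 * G 2 j - fpTr G * w j|
        ≤ |w 0 * G 0 j + w 1 * G 1 j + w 2 * G 2 j| + |fpTr G * w j| := abs_sub _ _
      _ ≤ |w 0 * G 0 j| + |w 1 * G 1 j| + |w 2 * G 2 j| + |fpTr G * w j| := by
          linarith [abs_add_three (w 0 * G 0 j) (w 1 * G 1 j) (w 2 * G 2 j)]
      _ ≤ 6 * K * W := by linarith [e 0, e 1, e 2]
  have hsplit : fpFlux v y j = t ^ 4 * (fpSq w * y j + 7 * fpDot y w * w j) +
      t ^ 3 * (w 0 * G 0 j + w 1 * G 1 j + w 2 * G 2 j - fpTr G * w j) := by rw [ht, hw', hG']; rfl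
  rw [hsplit]
  calc |t ^ 4 * (fpSq w * y j + 7 * fpDot y w * w j) + t ^ 3 * (w 0 * G 0 j + w 1 * G 1 j + w 2 * G 2 j - fpTr G * w j)|
      ≤ |t ^ 4 * (fpSq w * y j + 7 * fpDot y w * w j)| + |t ^ 3 * (w 0 * G 0 j + w 1 * G 1 j + w 2 * G 2 j - fpTr G * w j)| :=
        abs_add_le _ _
    _ = t ^ 4 * |fpSq w * y j + 7 * fpDot y w * w j| + t ^ 3 * |w 0 * G 0 j + w 1 * G 1 j + w 2 * G 2 j - fpTr G * w j| := by
        rw [abs_mul, abs_mul, abs_of_nonneg (pow_nonneg ht0 4), abs_of_nonneg (pow_nonneg ht0 3)]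
    _ ≤ t ^ 4 * (24 * ‖y‖ * W ^ 2) + t ^ 3 * (6 * K * W) := by gcongr
    _ = 24 * t ^ 4 * ‖y‖ * W ^ 2 + 6 * K * t ^ 3 * W := by ring

/-! ## Measurability of the three integrands for an arbitrary continuous field -/

section measurability
variable {v : (Fin 3 → ℝ) → (Fin 3 → ℝ)} {χ : (Fin 3 → ℝ) → ℝ}

/-- Each entry of the gradient matrix is a measurable function of the point (for ANY field: `fderiv` is Borel). -/
theorem measurable_fpGrad_apply (v : (Fin 3 → ℝ) → (Fin 3 → ℝ)) (i j : Fin 3) : Measurable fun x => fpGrad v x i j := by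
  unfold fpGrad
  exact (measurable_pi_apply j).comp (measurable_fderiv_apply_const ℝ v (fpE i))

/-- `x ↦ |x|⁻²` is measurable. -/
theorem measurable_fpSq_inv : Measurable fun x : Fin 3 → ℝ => (fpSq x)⁻¹ :=
  continuous_fpSq.measurable.inv

/-- The demand integrand `χ²·Num(x, v, ∇v)` is measurable for continuous `v`, `χ`. -/
theorem measurable_chiSq_mul_fpNum (hv : Continuous v) (hχ : Continuous χ) :
    Measurable fun x => χ x ^ 2 * fpNum x (v x) (fpGrad v x) := by
  have hg := measurable_fpGrad_apply v
  have hvi : ∀ i, Measurable fun x => v x i := fun i => (continuous_apply i).measurable.comp hv.measurable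
  have hxi : ∀ i : Fin 3, Measurable fun x : Fin 3 → ℝ => x i := fun i => measurable_pi_apply i
  have hs := measurable_fpSq_inv
  have hfrob : Measurable fun x => fpFrob (fpGrad v x) := by
    unfold fpFrob; fun_prop
  have hdot : Measurable fun x => fpDot x (v x) := by
    unfold fpDot; fun_prop
  have hvs : Measurable fun x => v x 0 ^ 2 + v x 1 ^ 2 + v x 2 ^ 2 := by fun_prop
  have h : Measurable fun x => χ x ^ 2 * (1 / 24 * (fpSq x)⁻¹ ^ 3 * fpFrob (fpGrad v x) + 2 * (fpSq x)⁻¹ ^ 5 * fpDot x (v x) ^ 2 -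
      1 / 4 * (fpSq x)⁻¹ ^ 4 * (v x 0 ^ 2 + v x 1 ^ 2 + v x 2 ^ 2)) := by
    fun_prop
  exact h

/-- The receipts integrand `χ²·Den(x, ∇v)` is measurable. -/
theorem measurable_chiSq_mul_fpDen (hχ : Continuous χ) : Measurable fun x => χ x ^ 2 * fpDen x (fpGrad v x) := by
  have hg := measurable_fpGrad_apply v
  have hs := measurable_fpSq_inv
  have hrec : Measurable fun x => fpRec (fpGrad v x) := by
    unfold fpRec fpTr fpSymSq; fun_prop
  have h : Measurable fun x => χ x ^ 2 * ((fpSq x)⁻¹ ^ 3 * fpRec (fpGrad v x)) := by fun_prop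
  exact h

/-- Each flux component `Φⱼ(v)(x)` is measurable for continuous `v`. -/
theorem measurable_fpFlux (hv : Continuous v) (j : Fin 3) : Measurable fun x => fpFlux v x j := by
  have hg := measurable_fpGrad_apply v
  have hvi : ∀ i, Measurable fun x => v x i := fun i => (continuous_apply i).measurable.comp hv.measurable
  have hxi : ∀ i : Fin 3, Measurable fun x : Fin 3 → ℝ => x i := fun i => measurable_pi_apply i
  have hs := measurable_fpSq_inv
  have hdot : Measurable fun x => fpDot x (v x) := by
    unfold fpDot; fun_prop
  have hvs : Measurable fun x => fpSq (v x) := by unfold fpSq; fun_prop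
  have htr : Measurable fun x => fpTr (fpGrad v x) := by unfold fpTr; fun_prop
  have h : Measurable fun x => (fpSq x)⁻¹ ^ 4 * (fpSq (v x) * x j + 7 * fpDot x (v x) * v x j) +
      (fpSq x)⁻¹ ^ 3 * (v x 0 * fpGrad v x 0 j + v x 1 * fpGrad v x 1 j + v x 2 * fpGrad v x 2 j - fpTr (fpGrad v x) * v x j) := by
    fun_prop
  exact h

/-- The flux integrand `2χ⟪∇χ, Φ(v)⟫` is measurable for continuous `v` and `C²` `χ`. -/
theorem measurable_two_chi_fluxDotGrad (hv : Continuous v) (hχ : ContDiff ℝ 2 χ) :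
    Measurable fun x => 2 * χ x * fpFluxDotGrad v χ x := by
  have hf := measurable_fpFlux hv
  have hgs : ∀ j, Measurable fun x => fpGradS χ x j := fun j => (continuous_fpGradS hχ j).measurable
  have hc : Measurable χ := hχ.continuous.measurable
  have h : Measurable fun x => 2 * χ x * (fpGradS χ x 0 * fpFlux v x 0 + fpGradS χ x 1 * fpFlux v x 1 + fpGradS χ x 2 * fpFlux v x 2) := by
    fun_prop
  exact h

end measurability

/-! ## Dominating functions -/

section domination
variable {χ : (Fin 3 → ℝ) → ℝ} {R : ℝ}

/-- `χ = O(1)` at infinity for a weight equal to `1` on the tail. -/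
theorem isBigO_chi_of_tail (hχ1 : ∀ y : Fin 3 → ℝ, R ≤ ‖y‖ → χ y = 1) :
    (fun y => χ y) =O[cocompact (Fin 3 → ℝ)] fun y => ‖y‖ ^ (0 : ℤ) := by
  refine IsBigO.of_bound 1 ?_
  filter_upwards [eventually_cocompact_norm_ge R] with y hy
  rw [hχ1 y hy]
  simp

/-- The demand/receipt dominating function `χ²(c₃|x|⁻⁶ + c₄|x|⁻⁸)` is integrable. -/
theorem integrable_chiSq_mul_invPow (hχ : ContDiff ℝ 2 χ) (hχ0 : (0 : Fin 3 → ℝ) ∉ tsupport χ)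
    (hχ1 : ∀ y : Fin 3 → ℝ, R ≤ ‖y‖ → χ y = 1) (c₃ c₄ : ℝ) :
    Integrable fun x => χ x ^ 2 * (c₃ * (fpSq x)⁻¹ ^ 3 + c₄ * (fpSq x)⁻¹ ^ 4) := by
  have hcont : Continuous fun x => χ x ^ 2 * (c₃ * (fpSq x)⁻¹ ^ 3 + c₄ * (fpSq x)⁻¹ ^ 4) := by
    refine continuous_weight_mul (hχ.continuous.pow 2) (chiSq_eventually_zero hχ0) fun y hy => ?_
    exact ((continuousAt_const.mul ((continuousAt_fpSq_inv hy).pow 3)).add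
      (continuousAt_const.mul ((continuousAt_fpSq_inv hy).pow 4)))
  have hO : (fun x => χ x ^ 2 * (c₃ * (fpSq x)⁻¹ ^ 3 + c₄ * (fpSq x)⁻¹ ^ 4)) =O[cocompact (Fin 3 → ℝ)]
      fun y => ‖y‖ ^ (-6 : ℤ) := by
    have h3 : (fun x => c₃ * (fpSq x)⁻¹ ^ 3) =O[cocompact (Fin 3 → ℝ)] fun y => ‖y‖ ^ (-6 : ℤ) :=
      isBigO_gauge_up (isBigO_gauge_mul' (isBigO_const_gauge c₃) (isBigO_fpSq_inv_pow_gauge 3)) (by norm_num)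
    have h4 : (fun x => c₄ * (fpSq x)⁻¹ ^ 4) =O[cocompact (Fin 3 → ℝ)] fun y => ‖y‖ ^ (-6 : ℤ) :=
      isBigO_gauge_up (isBigO_gauge_mul' (isBigO_const_gauge c₄) (isBigO_fpSq_inv_pow_gauge 4)) (by norm_num)
    exact isBigO_gauge_up (isBigO_gauge_mul' (isBigO_chiSq_gauge (isBigO_chi_of_tail hχ1)) (h3.add h4)) (by norm_num)
  exact integrable_of_isBigO_gauge hcont (by norm_num) hO

/-- The flux dominating function `(Σⱼ |2χ∂ⱼχ|)·(c₄|x|⁻⁸‖x‖(V + K‖x‖)² + c₃|x|⁻⁶(V + K‖x‖))` is integrable (continuous, compact support). -/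
theorem integrable_fluxBound (hχ : ContDiff ℝ 2 χ) (hχ0 : (0 : Fin 3 → ℝ) ∉ tsupport χ)
    (hχ1 : ∀ y : Fin 3 → ℝ, R ≤ ‖y‖ → χ y = 1) (c₃ c₄ K V : ℝ) :
    Integrable fun x => (|2 * χ x * fpGradS χ x 0| + |2 * χ x * fpGradS χ x 1| + |2 * χ x * fpGradS χ x 2|) *
      (c₄ * (fpSq x)⁻¹ ^ 4 * ‖x‖ * (V + K * ‖x‖) ^ 2 + c₃ * K * (fpSq x)⁻¹ ^ 3 * (V + K * ‖x‖)) := by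
  have hw : Continuous fun x => |2 * χ x * fpGradS χ x 0| + |2 * χ x * fpGradS χ x 1| + |2 * χ x * fpGradS χ x 2| :=
    (((continuous_two_mul_chi_grad hχ 0).abs).add ((continuous_two_mul_chi_grad hχ 1).abs)).add
      ((continuous_two_mul_chi_grad hχ 2).abs)
  have hw0 : ∀ᶠ y in 𝓝 (0 : Fin 3 → ℝ), |2 * χ y * fpGradS χ y 0| + |2 * χ y * fpGradS χ y 1| + |2 * χ y * fpGradS χ y 2| = 0 := by
    filter_upwards [two_mul_chi_grad_eventually_zero hχ0 0, two_mul_chi_grad_eventually_zero hχ0 1,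
      two_mul_chi_grad_eventually_zero hχ0 2] with y h0 h1 h2
    simp [h0, h1, h2]
  have hcont : Continuous fun x => (|2 * χ x * fpGradS χ x 0| + |2 * χ x * fpGradS χ x 1| + |2 * χ x * fpGradS χ x 2|) *
      (c₄ * (fpSq x)⁻¹ ^ 4 * ‖x‖ * (V + K * ‖x‖) ^ 2 + c₃ * K * (fpSq x)⁻¹ ^ 3 * (V + K * ‖x‖)) := by
    refine continuous_weight_mul hw hw0 fun y hy => ?_
    have hs := continuousAt_fpSq_inv hy
    have hn : ContinuousAt (fun x : Fin 3 → ℝ => ‖x‖) y := continuous_norm.continuousAt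
    exact ((((continuousAt_const.mul (hs.pow 4)).mul hn).mul ((continuousAt_const.add (continuousAt_const.mul hn)).pow 2)).add
      (((continuousAt_const.mul (hs.pow 3))).mul (continuousAt_const.add (continuousAt_const.mul hn))))
  have hsupp : HasCompactSupport fun x => (|2 * χ x * fpGradS χ x 0| + |2 * χ x * fpGradS χ x 1| + |2 * χ x * fpGradS χ x 2|) *
      (c₄ * (fpSq x)⁻¹ ^ 4 * ‖x‖ * (V + K * ‖x‖) ^ 2 + c₃ * K * (fpSq x)⁻¹ ^ 3 * (V + K * ‖x‖)) := by
    refine HasCompactSupport.intro (isCompact_closedBall (0 : Fin 3 → ℝ) R) fun x hx => ?_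
    have hxR : R < ‖x‖ := by simpa [mem_closedBall, dist_zero_right] using hx
    have hz := fpGradS_eq_zero_of_tail hχ1 hxR
    simp [hz]
  exact hcont.integrable_of_hasCompactSupport hsupp

end domination

end Summit.AtomisticToContinuum.Crystallization.Theorems.StrictSplittingRuleBirth
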